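import Summits.ABC.IUTFork.LDHSUnitFamilyPoint
import Summits.ABC.IUTFork.LDHSlotRegimePointNecessitySharpRegime
import Summits.ABC.IUTFork.Conditional.AbcOfSHvolGenuineFamily
import HarnessLib

/-!
# The S-unit quadratic family of the `λ`-line: IV. The mixed sum of the sharp necessity at the prime `5`, the core
# arithmetic, and the exponents `a, c ≡ 1 (mod l)`

Record-only PROOF file (D-0012) of the abc-iut cell (R2 S-chain team, seat abc-iut-s2-p4 gen 4); TAKES NO SIDE on [IUTchIII] Cor. 3.12,
on [IUTchIV] Thm. 1.10, or on any author. S. Mochizuki, *IUT IV* [Mochizuki2012], Thm. 1.10 proof Step (v) pp. 27–28; Cor. 2.2 (ii) proof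
(P1)–(P7) pp. 45–46; Dupuy–Hilado [DupuyHilado2025] §3.3, §3.6, §4.7; cell note plan/c312/STEPV-IND1-NOTE.md (reading (U)).

* `SUnitFamily.mixed_data_at_five` — at `P_{a,c}` (parts I–III; `ℚ(j(λ)) = F`, so the places of `ℚ(j(λ))` over `5` are `𝔭₁` (bad,
  `h♭ = 2a·log 5`) and `𝔭₂` (good), by abc-iut-s2-p3's transport `finBelow`): in the vocabulary of abc-iut-s2-p1's sharp necessity
  (`PointDict.pointMixedShare_le_slack_of_hvol`), `ω₅ = 1/2` and the mixed sum at `5` is `a·log 5`;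
* `SUnitFamily.core_bound` — the slack inequality with `W = {5}`, `d_mod = 2`, `lD ≤ a·log 5 + ½ log 5`, `lC ≤ ½(log 5 + 2 log 7)` forces
  `a·log 5 ≤ K(l)` for `l ≥ 173` (`m(l) = (l+1)/24 − 8/(l(l−1)) − 7 − 6/l ≥ 1/5`);
* `SUnitFamily.exists_exponents` — for every `l ≥ 2` and `n`: exponents `a, c ≥ n+1`, `l ∤ a`, `l ∤ c`, `7^c ≤ 5^a ≤ 5^l·7^c`;
* `SUnitFamily.logDiff_le_linear` — `log-diff(P_{a,c}) ≤ a·log 5 + ½·log 5` when `7^c ≤ 5^a`.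
Consumed by `Conditional/AbcOfSHvolRefutationFixedPrime.lean`. Nothing asserted about Θ-data; no side taken.
[cite: Mochizuki2012, IUTchIV Thm. 1.10 proof Step (v) p. 27–28] [cite: DupuyHilado2025, §3.3, §3.6, §4.7]
[claim: Mochizuki2012, status: disputed] for every IUT quotation.
-/

noncomputable section

namespace Summit.ABC.IUTFork

open NumberField IsDedekindDomain Literature.IUT.LogVolume Literature.IUT.LogVolume.Cor22 Literature.IUT.HodgeTheaters
open Literature.NumberTheory.DiophantineGeometry.GenEll
open scoped Classical

namespace SUnitFamily

/-! ## The mixed sum of the sharp necessity at the prime `5`, read on `F_{a,c}` -/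

section Transport

variable {a c : ℕ} (ha : 1 ≤ a) (hc : 1 ≤ c) {l : ℕ} (hl : l.Prime) (hl5 : l ≠ 5)
include ha hc hl hl5

/-- **At `P_{a,c}`, prime `5`, any prime `l ≠ 5`: `ω₅ = 1/2` and the mixed sum `Σ_V 𝟙[bad]·Pr·h♭ = a·log 5`** — both read on the places of
`ℚ(j(λ)) = F` (abc-iut-s2-p3's transport `finBelow` bijection, weights and normalised local heights invariant); `𝔭₁` is bad with `h♭ = 2a·log 5`,
`𝔭₂` is good. [cite: DupuyHilado2025, §3.3, §3.6] [claim: Mochizuki2012, status: disputed] -/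
theorem mixed_data_at_five :
    (∑ V ∈ Finset.univ.filter
        (fun V : placesOver ↥(IntermediateField.adjoin ℚ ({Cor22.jInv (Pt a c).x} : Set (Pt a c).F)) 5 =>
          ¬ (ord _ V.1 (Cor22.jMod (Pt a c)) < 0 ∧ ((2 : ℕ) : 𝓞 _) ∉ V.1.asIdeal ∧ ((l : ℕ) : 𝓞 _) ∉ V.1.asIdeal)),
        weight _ V.1) = 1 / 2 ∧
    (∑ V : placesOver ↥(IntermediateField.adjoin ℚ ({Cor22.jInv (Pt a c).x} : Set (Pt a c).F)) 5,
        (if ord _ V.1 (Cor22.jMod (Pt a c)) < 0 ∧ ((2 : ℕ) : 𝓞 _) ∉ V.1.asIdeal ∧ ((l : ℕ) : 𝓞 _) ∉ V.1.asIdeal then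
          weight _ V.1 * (((-ord _ V.1 (Cor22.jMod (Pt a c)) : ℤ) : ℝ) * logNorm _ V.1 / (localDegree _ V.1 : ℝ))
         else 0)) = (a : ℝ) * Real.log 5 := by
  haveI : Fact (Nat.Prime 5) := ⟨by norm_num⟩
  set P : NFPoint := Pt a c with hPdef
  set Fm : Type := ↥(IntermediateField.adjoin ℚ ({Cor22.jInv P.x} : Set P.F)) with hFm
  have htop : IntermediateField.adjoin ℚ ({Cor22.jInv P.x} : Set P.F) = ⊤ := adjoin_jInv_eq_top ha hc
  obtain ⟨𝔭₁, 𝔭₂, -, -, ⟨h1, h1', h15, ho1⟩, ⟨h2, -, h25, -⟩, -, -⟩ := exists_four_places ha hc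
  have hpair : placesOver P.F 5 = {𝔭₁, 𝔭₂} := placesOver_eq_pair (p := 5) h1 h2 h15 h25
  have hne : 𝔭₁ ≠ 𝔭₂ := (ne_of_sep h1 h2).symm
  -- the bijection of places over `5`
  have hinj := PointDict.finBelow_injective_of_adjoin_eq_top (P := P) htop
  let e : ↥(placesOver P.F 5) → ↥(placesOver Fm 5) := fun W => ⟨finBelow Fm P.F W.1, finBelow_mem_placesOver Fm P.F W.2⟩
  have he_inj : Function.Injective e := fun W W' h => Subtype.ext (hinj (congrArg Subtype.val h))
  have he_surj : Function.Surjective e := by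
    intro V
    have hsum := sum_filter_finBelow_weight Fm P.F V.1 V.2
    have hpos : 0 < weight Fm V.1 := by
      unfold weight; exact div_pos (by exact_mod_cast localDegree_pos Fm V.1) (by exact_mod_cast Module.finrank_pos)
    rw [← hsum] at hpos
    obtain ⟨W, hW, -⟩ := Finset.exists_ne_zero_of_sum_ne_zero hpos.ne'
    rw [Finset.mem_filter] at hW
    exact ⟨⟨W, hW.1⟩, Subtype.ext hW.2⟩
  let eqv : ↥(placesOver P.F 5) ≃ ↥(placesOver Fm 5) := Equiv.ofBijective e ⟨he_inj, he_surj⟩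
  -- per-place dictionary
  have hj : algebraMap Fm P.F (Cor22.jMod P) = Cor22.jInv P.x := rfl
  have hbad_iff : ∀ W : HeightOneSpectrum (𝓞 P.F),
      (ord Fm (finBelow Fm P.F W) (Cor22.jMod P) < 0 ∧ ((2 : ℕ) : 𝓞 Fm) ∉ (finBelow Fm P.F W).asIdeal ∧
          ((l : ℕ) : 𝓞 Fm) ∉ (finBelow Fm P.F W).asIdeal) ↔
        (ord P.F W (Cor22.jInv P.x) < 0 ∧ ((2 : ℕ) : 𝓞 P.F) ∉ W.asIdeal ∧ ((l : ℕ) : 𝓞 P.F) ∉ W.asIdeal) := by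
    intro W
    have e1 : ord Fm (finBelow Fm P.F W) (Cor22.jMod P) < 0 ↔ ord P.F W (Cor22.jInv P.x) < 0 :=
      (Cor22.ord_algebraMap_neg_iff W (Cor22.jMod P)).symm
    exact Iff.and e1 (Iff.and (Cor22.natCast_mem_asIdeal_finBelow_iff W 2).not (Cor22.natCast_mem_asIdeal_finBelow_iff W l).not)
  have hval : ∀ W : HeightOneSpectrum (𝓞 P.F), W ∈ placesOver P.F 5 →
      weight Fm (finBelow Fm P.F W) * (((-ord Fm (finBelow Fm P.F W) (Cor22.jMod P) : ℤ) : ℝ) * logNorm Fm (finBelow Fm P.F W) /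
          (localDegree Fm (finBelow Fm P.F W) : ℝ)) =
        weight P.F W * (-((ord P.F W (Cor22.jInv P.x) : ℝ) * logNorm P.F W / (localDegree P.F W : ℝ))) := by
    intro W hW
    rw [PointDict.weight_finBelow_eq_of_adjoin_eq_top htop W hW]
    have hh : (ord P.F W (Cor22.jInv P.x) : ℝ) * logNorm P.F W / (localDegree P.F W : ℝ) =
        (ord Fm (finBelow Fm P.F W) (Cor22.jMod P) : ℝ) * logNorm Fm (finBelow Fm P.F W) / (localDegree Fm (finBelow Fm P.F W) : ℝ) :=
      ord_mul_logNorm_div_localDegree_algebraMap (F₀ := Fm) (K := P.F) W (Cor22.jMod P)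
    rw [hh]
    push_cast
    ring
  -- facts at `𝔭₁`, `𝔭₂`
  have hv1 : 𝔭₁ ∈ placesOver P.F 5 := mem_placesOver_of_natCast_mem 5 𝔭₁ h15
  have hv2 : 𝔭₂ ∈ placesOver P.F 5 := mem_placesOver_of_natCast_mem 5 𝔭₂ h25
  have hord1 : ord P.F 𝔭₁ (Cor22.jInv P.x) = -(2 * (a : ℤ)) := (ord_at_p1 hc h15 h1 h1' ho1).1
  have hord2 : 0 ≤ ord P.F 𝔭₂ (Cor22.jInv P.x) := (ord_at_p2 hc h25 h2).1
  have h2_1 : ((2 : ℕ) : 𝓞 P.F) ∉ 𝔭₁.asIdeal := SplitDepth.natCast_not_mem_of_prime_ne ⟨𝔭₁, hv1⟩ Nat.prime_two (by norm_num)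
  have hl_1 : ((l : ℕ) : 𝓞 P.F) ∉ 𝔭₁.asIdeal := SplitDepth.natCast_not_mem_of_prime_ne ⟨𝔭₁, hv1⟩ hl hl5
  have hbad1 : ord P.F 𝔭₁ (Cor22.jInv P.x) < 0 ∧ ((2 : ℕ) : 𝓞 P.F) ∉ 𝔭₁.asIdeal ∧ ((l : ℕ) : 𝓞 P.F) ∉ 𝔭₁.asIdeal :=
    ⟨by rw [hord1]; omega, h2_1, hl_1⟩
  have hgood2 : ¬ (ord P.F 𝔭₂ (Cor22.jInv P.x) < 0 ∧ ((2 : ℕ) : 𝓞 P.F) ∉ 𝔭₂.asIdeal ∧ ((l : ℕ) : 𝓞 P.F) ∉ 𝔭₂.asIdeal) :=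
    fun h => absurd hord2 (not_le.mpr h.1)
  have hw := weight_pair_eq_half (p := 5) h1 h2 h15 h25
  have hn1 : localDegree P.F 𝔭₁ = 1 := (localDegree_pair_eq_one (p := 5) h1 h2 h15 h25).1
  have hbad1' := (hbad_iff 𝔭₁).mpr hbad1
  have hgood2' : ¬ (ord Fm (finBelow Fm P.F 𝔭₂) (Cor22.jMod P) < 0 ∧ ((2 : ℕ) : 𝓞 Fm) ∉ (finBelow Fm P.F 𝔭₂).asIdeal ∧
      ((l : ℕ) : 𝓞 Fm) ∉ (finBelow Fm P.F 𝔭₂).asIdeal) := fun h => hgood2 ((hbad_iff 𝔭₂).mp h)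
  constructor
  · -- `ω₅`
    rw [Finset.sum_filter, Fintype.sum_equiv eqv.symm _ (fun W : ↥(placesOver P.F 5) =>
        if ¬ (ord Fm (finBelow Fm P.F W.1) (Cor22.jMod P) < 0 ∧ ((2 : ℕ) : 𝓞 Fm) ∉ (finBelow Fm P.F W.1).asIdeal ∧
            ((l : ℕ) : 𝓞 Fm) ∉ (finBelow Fm P.F W.1).asIdeal) then weight Fm (finBelow Fm P.F W.1) else 0)
        (fun V => by
          have hV : (eqv (eqv.symm V)) = V := eqv.apply_symm_apply V
          conv_lhs => rw [← hV]
          rfl),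
      Finset.sum_coe_sort (placesOver P.F 5) (fun W => if ¬ (ord Fm (finBelow Fm P.F W) (Cor22.jMod P) < 0 ∧
          ((2 : ℕ) : 𝓞 Fm) ∉ (finBelow Fm P.F W).asIdeal ∧ ((l : ℕ) : 𝓞 Fm) ∉ (finBelow Fm P.F W).asIdeal) then
            weight Fm (finBelow Fm P.F W) else 0),
      hpair, Finset.sum_pair hne, if_neg (not_not.mpr hbad1'), if_pos hgood2',
      PointDict.weight_finBelow_eq_of_adjoin_eq_top htop 𝔭₂ hv2, hw.2.1]
    norm_num
  · -- the mixed sum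
    rw [Fintype.sum_equiv eqv.symm _ (fun W : ↥(placesOver P.F 5) =>
        if (ord Fm (finBelow Fm P.F W.1) (Cor22.jMod P) < 0 ∧ ((2 : ℕ) : 𝓞 Fm) ∉ (finBelow Fm P.F W.1).asIdeal ∧
            ((l : ℕ) : 𝓞 Fm) ∉ (finBelow Fm P.F W.1).asIdeal) then
          weight Fm (finBelow Fm P.F W.1) * (((-ord Fm (finBelow Fm P.F W.1) (Cor22.jMod P) : ℤ) : ℝ) *
            logNorm Fm (finBelow Fm P.F W.1) / (localDegree Fm (finBelow Fm P.F W.1) : ℝ)) else 0)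
        (fun V => by
          have hV : (eqv (eqv.symm V)) = V := eqv.apply_symm_apply V
          conv_lhs => rw [← hV]
          rfl),
      Finset.sum_coe_sort (placesOver P.F 5) (fun W => if (ord Fm (finBelow Fm P.F W) (Cor22.jMod P) < 0 ∧
          ((2 : ℕ) : 𝓞 Fm) ∉ (finBelow Fm P.F W).asIdeal ∧ ((l : ℕ) : 𝓞 Fm) ∉ (finBelow Fm P.F W).asIdeal) then
            weight Fm (finBelow Fm P.F W) * (((-ord Fm (finBelow Fm P.F W) (Cor22.jMod P) : ℤ) : ℝ) *
              logNorm Fm (finBelow Fm P.F W) / (localDegree Fm (finBelow Fm P.F W) : ℝ)) else 0),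
      hpair, Finset.sum_pair hne, if_pos hbad1', if_neg hgood2', hval 𝔭₁ hv1, hw.1.1, hw.1.2, hn1, hord1]
    push_cast
    ring

end Transport

/-! ## The core arithmetic: the slack inequality fails for `a` large at any fixed `l ≥ 173` -/

/-- **CORE.** For a prime `l ≥ 173`, `a, c ≥ 1` with `7^c ≤ 5^a`: IF the sharp slack inequality of abc-iut-s2-p1 holds at `P_{a,c}` with
`W = {5}` — «`(a·log 5/(2l))·(l(l+1)/12 − 16/(l−1)) ≤ (4d−1+3d/l)(lD+lC) + ((l+5−4d)/(4l))·lC + ((l+1)/4)·E`» with `d = 2`,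
`lD = log-diff ≤ a·log 5 + ½·log 5`, `lC ≤ ½(log 5 + 2 log 7)` and ANY `E ≥ 0` not depending on `a` — THEN `a·log 5 ≤ 5·(8·(log 5 + 2 log 7) + 4·log 5 + (l+1)/4·E)`.
Pure real arithmetic (`(l+1)/24 − 8/(l(l−1)) − 7 − 6/l ≥ 1/5` for `l ≥ 173`). [folklore] -/
theorem core_bound {l : ℕ} (h173 : 173 ≤ l) {a : ℕ} {lD lC E M : ℝ}
    (hlD0 : 0 ≤ lD) (hlC0 : 0 ≤ lC) (hlD : lD ≤ (a : ℝ) * Real.log 5 + Real.log 5 / 2)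
    (hlC : lC ≤ (Real.log 5 + 2 * Real.log 7) / 2)
    (hM : M = (a : ℝ) * Real.log 5)
    (hslack : 1 / (2 * (l : ℝ)) * M * ((l : ℝ) * ((l : ℝ) + 1) / 12 - 4 * (1 - 1 / 2) / (((l : ℝ) - 1) * (1 / 2) ^ 3)) ≤
      (4 * (2 : ℝ) - 1 + 3 * (2 : ℝ) / l) * (lD + lC) + ((l : ℝ) + 5 - 4 * (2 : ℝ)) / (4 * (l : ℝ)) * lC + ((l : ℝ) + 1) / 4 * E) :
    (a : ℝ) * Real.log 5 ≤ 5 * (8 * ((Real.log 5 + 2 * Real.log 7) / 2) + 8 * (Real.log 5 / 2) + ((l : ℝ) + 1) / 4 * E) := by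
  have hl : (173 : ℝ) ≤ (l : ℝ) := by exact_mod_cast h173
  have hl0 : (0 : ℝ) < l := by linarith
  have hl1 : (0 : ℝ) < (l : ℝ) - 1 := by linarith
  have hlog5 : 0 < Real.log 5 := Real.log_pos (by norm_num)
  have hlog7 : 0 < Real.log 7 := Real.log_pos (by norm_num)
  have hM0 : 0 ≤ M := by rw [hM]; positivity
  -- simplify the tail: `4·(1/2)/((l−1)/8) = 16/(l−1)`
  have htail : 1 / (2 * (l : ℝ)) * M * ((l : ℝ) * ((l : ℝ) + 1) / 12 - 4 * (1 - 1 / 2) / (((l : ℝ) - 1) * (1 / 2) ^ 3)) =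
      M * (((l : ℝ) + 1) / 24 - 8 / ((l : ℝ) * ((l : ℝ) - 1))) := by
    field_simp
    ring
  rw [htail] at hslack
  -- lower bound the coefficient: `(l+1)/24 − 8/(l(l−1)) ≥ 174/24 − 8/(173·172)`
  have hc1 : (174 : ℝ) / 24 ≤ ((l : ℝ) + 1) / 24 := by linarith
  have hc2 : 8 / ((l : ℝ) * ((l : ℝ) - 1)) ≤ 8 / (173 * 172) :=
    div_le_div_of_nonneg_left (by norm_num) (by norm_num) (by nlinarith)
  have hc3 : 3 * (2 : ℝ) / l ≤ 6 / 173 := by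
    rw [show 3 * (2 : ℝ) / l = 6 / l by ring]
    exact div_le_div_of_nonneg_left (by norm_num) (by norm_num) hl
  have hc4 : ((l : ℝ) + 5 - 4 * 2) / (4 * (l : ℝ)) ≤ 1 / 4 := by
    rw [div_le_iff₀ (by linarith)]; linarith
  -- right-hand side ≤ (7 + 6/173)(lD + lC) + lC/4 + (l+1)/4·E
  have hR : (4 * (2 : ℝ) - 1 + 3 * (2 : ℝ) / l) * (lD + lC) + ((l : ℝ) + 5 - 4 * (2 : ℝ)) / (4 * (l : ℝ)) * lC + ((l : ℝ) + 1) / 4 * E ≤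
      (7 + 6 / 173) * (lD + lC) + 1 / 4 * lC + ((l : ℝ) + 1) / 4 * E := by
    have h1 : (4 * (2 : ℝ) - 1 + 3 * (2 : ℝ) / l) * (lD + lC) ≤ (7 + 6 / 173) * (lD + lC) :=
      mul_le_mul_of_nonneg_right (by linarith) (by linarith)
    have h2 : ((l : ℝ) + 5 - 4 * (2 : ℝ)) / (4 * (l : ℝ)) * lC ≤ 1 / 4 * lC := mul_le_mul_of_nonneg_right hc4 hlC0
    linarith
  -- left-hand side ≥ M·(174/24 − 8/(173·172))
  have hL : M * ((174 : ℝ) / 24 - 8 / (173 * 172)) ≤ M * (((l : ℝ) + 1) / 24 - 8 / ((l : ℝ) * ((l : ℝ) - 1))) :=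
    mul_le_mul_of_nonneg_left (by linarith) hM0
  rw [hM] at hL hslack
  nlinarith

/-! ## The family index: exponents `a, c ≡ 1 (mod l)` with `7^c ≤ 5^a < 5^l·7^c` -/

/-- For every `l ≥ 2` and `n` there are exponents `a, c ≥ n + 1`, both `≡ 1 (mod l)`, with `7^c ≤ 5^a ≤ 5^l·7^c`. [folklore] -/
theorem exists_exponents (l : ℕ) (hl : 2 ≤ l) (n : ℕ) :
    ∃ a c : ℕ, n + 1 ≤ a ∧ n + 1 ≤ c ∧ ¬ l ∣ a ∧ ¬ l ∣ c ∧ 7 ^ c ≤ 5 ^ a ∧ 5 ^ a ≤ 5 ^ l * 7 ^ c := by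
  set c : ℕ := l * n + 1 with hcdef
  have hex : ∃ k : ℕ, 7 ^ c ≤ 5 ^ (l * k + 1) := ⟨2 * c, by
    calc 7 ^ c ≤ 25 ^ c := Nat.pow_le_pow_left (by norm_num) c
      _ = 5 ^ (2 * c) := by rw [pow_mul]; norm_num
      _ ≤ 5 ^ (l * (2 * c) + 1) := Nat.pow_le_pow_right (by norm_num) (by nlinarith)⟩
  obtain ⟨k, hk, hmin⟩ : ∃ k, 7 ^ c ≤ 5 ^ (l * k + 1) ∧ ∀ m < k, ¬ 7 ^ c ≤ 5 ^ (l * m + 1) :=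
    ⟨Nat.find hex, Nat.find_spec hex, fun m hm => Nat.find_min hex hm⟩
  have hndvd : ∀ m : ℕ, ¬ l ∣ l * m + 1 := fun m h => by
    have : l ∣ 1 := (Nat.dvd_add_right (dvd_mul_right l m)).mp h
    have := Nat.le_of_dvd one_pos this
    omega
  have hc1 : 1 ≤ c := by rw [hcdef]; omega
  have hk1 : 1 ≤ k := by
    by_contra h0
    have hk0 : k = 0 := by omega
    rw [hk0, mul_zero, zero_add, pow_one] at hk
    have : 7 ≤ 7 ^ c := Nat.le_self_pow (by omega) 7
    omega
  refine ⟨l * k + 1, c, ?_, by rw [hcdef]; nlinarith, hndvd k, hndvd n, hk, ?_⟩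
  · -- `a ≥ n + 1`: `5^a ≥ 7^c ≥ 5^c` gives `a ≥ c ≥ n + 1`
    have h5c : 5 ^ c ≤ 5 ^ (l * k + 1) := le_trans (Nat.pow_le_pow_left (by norm_num) c) hk
    have := (Nat.pow_le_pow_iff_right (by norm_num : 1 < 5)).mp h5c
    rw [hcdef] at this; nlinarith
  · -- minimality of `k`: `5^{l(k−1)+1} < 7^c`
    have hlt : ¬ 7 ^ c ≤ 5 ^ (l * (k - 1) + 1) := hmin (k - 1) (by omega)
    push Not at hlt
    have : 5 ^ (l * k + 1) = 5 ^ l * 5 ^ (l * (k - 1) + 1) := by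
      rw [← pow_add]; congr 1
      obtain ⟨k', rfl⟩ := Nat.exists_eq_add_of_le' hk1
      simp only [Nat.add_sub_cancel]
      ring
    rw [this]
    exact Nat.mul_le_mul_left _ hlt.le

/-- `log D ≤ (2a + 1)·log 5` when `7^c ≤ 5^a` (`D = 5^{2a} + 4·7^{2c} ≤ 5·5^{2a}`); hence `log-diff(P_{a,c}) ≤ a·log 5 + ½·log 5`. [folklore] -/
theorem logDiff_le_linear {a c : ℕ} (hlo : 7 ^ c ≤ 5 ^ a) : (Pt a c).logDiff ≤ (a : ℝ) * Real.log 5 + Real.log 5 / 2 := by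
  have h1 := logDiff_le (a := a) (c := c)
  have hD : (D a c : ℝ) ≤ 5 * (5 : ℝ) ^ (2 * a) := by
    have h72 : (7 : ℝ) ^ (2 * c) ≤ (5 : ℝ) ^ (2 * a) := by
      rw [mul_comm 2 c, mul_comm 2 a, pow_mul, pow_mul]
      exact pow_le_pow_left₀ (by positivity) (by exact_mod_cast hlo) 2
    unfold D; push_cast; nlinarith
  have hlog : Real.log (D a c) ≤ Real.log 5 + (2 * a) * Real.log 5 := by
    have := Real.log_le_log (by unfold D; positivity) hD
    rw [Real.log_mul (by norm_num) (by positivity), Real.log_pow] at this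
    push_cast at this ⊢; linarith
  linarith

end SUnitFamily

end Summit.ABC.IUTFork

end
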